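import Summits.QuantumFields.YangMills.Theorems.BalabanUVNodesPortU2Chart
import Literature.MathematicalPhysics.QuantumFieldTheory.Balaban1983to89.Node00.CriticalOnFibreTopGuardedBPrint
import Literature.MathematicalPhysics.QuantumFieldTheory.Balaban1983to89.Node00.TorusCoverGaugeTokensGuardedB
import Literature.MathematicalPhysics.QuantumFieldTheory.Balaban1983to89.Node00.Record12BgRowCoClassCPMFloorB
import Literature.MathematicalPhysics.QuantumFieldTheory.Balaban1983to89.Node00.LargeFieldBackgroundCoPOfRecord

/-!
# PORT PT-C, part 2 — THE SIGNED TEXT `BalabanUVNodes.PortRowE118U2` (stmt-QuantumFields-27932) PROVED: the record's exp-chart maps print's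
# scaled (4.4) domain `recordDom44 … α₂` into the record's space `U^c_{k+1}(X, α₀, α₁)`, with ONE `α₂ = min(1∕4, α₁, α₀∕16)` for every level `k`

Cell `ym-nodeO-ideate`, porter seat `ymgap-nodeO-port-PTC-1` (gen 0), director-ym brief R611 ∕ №444 (R-O2 of record) ∕ №445; signature =
`nodeO-cover/TYPER-Sig27932-v3-RO2.txt` sha16 `8330988af3c4ec91` (typer-1 g1; CRIT-1 g32 `check` rc 0 22:38:25Z) VERBATIM as the type of
`portRowE118U2` (the route file `Theses/BalabanUVNodes.lean` rev 29 does not yet render `def PortRowE118U2`, so — as for PT-D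
`BalabanUVNodesPortResummationU5b` ∕ 27929 — the text is stated in full and filed `--workitem stmt-QuantumFields-27932`; the gate renders the `def` and
its `_holds` link).  [I] = [Balaban1987RG1].  Part 1 = `BalabanUVNodesPortU2Chart` (domain structure, analyticity, plaquette estimate).

THE MATHEMATICS (print [I] (4.4) p.281 «defined and analytic on the space of configurations A satisfying max{|A|, |∇^ξA|, |Δ^ξA|} < α₂» read
against (1.11)–(1.16) p.262 AT THE RECORD'S NAMES).  `recordUc F Mc k α₀ α₁ K X` is the coordinate pull-back of 11b's `Sect2.spaceI` = [I]'s union of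
`Gᶜ`-orbits of pairs `(𝐔, 𝐉)` satisfying (i)–(iv), over the frame of record `Sect2.frameI (RzOfRecord F 2 K) …` whose (1.15) background functions are
the record's UNIT recipe (`Record12Residuals`: `U_n(M˙(·)) ≡ 1`, `J_n ≡ 0` — SAID there; so (iv) (1.16) holds for every configuration).  For
`w ∈ recordDom44 … α₂` the charted pair `𝐔(b) = exp W(b)` on the bonds in `X` (`1` off `X`), `𝐉 = 0`, `W = chartMat F K w`, satisfies (i)–(iii) with
the factorisation `𝐔 = exp(iξA′)·U`, `U := 1`, `A′ := (iξ)⁻¹W`:  (i) `∂1 = 1`, the (1.12) gauge `u = 1, A = 0` (`O(1)LMB = 6L + 1 > 0`);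
(ii) `A′ ∈ 𝔰𝔩₂(ℂ)`, `|A′| = ξ⁻¹|W| < α₂ ≤ α₁`, `|∇^ξ_1 A′| = ξ⁻²|W(b + e_μ) − W(b)| < α₂ ≤ α₁` (first two clauses of (4.4); the stencil's bonds lie
in `X` by 11b's reading (ℓ4) of «on X»);  (iii) `𝐉 = 0` and, by part 1's plaquette estimate with `r = α₂ξ ≤ 1∕4`, `r′ = α₂ξ²` (opposite sides
of a plaquette in `X` are ξ-neighbours in `X`), `|∂𝐔 − 1| ≤ 2α₂(1 + α₂)e^{4α₂}ξ² < 16α₂ξ² ≤ α₀ξ²`;  `𝐔 ∈ Gᶜ = SL(2, ℂ)` by `det exp W = e^{tr W} = 1`.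
Hence ★ `recordChart_mapsTo` for `0 < α₂ ≤ min(1∕4, α₁, α₀∕16)` — uniformly in `k`, `Mc`, `K`, `X` BECAUSE (4.4) is stated in the ξ-SCALED norms
(CRIT-1 ‼ nodeO STATUS l.3637: the unscaled polydisc text 27932″ was FALSE at these names; R-O2 = this text); ★ `chart44DAt_of_le` ∕
`exists_chart44DAt` (DEF-1's receipt `Chart44DAt F Mc k α₀ α₁ α₂` for ALL volumes `K`); ★★ `portRowE118U2` = the signed text (its ⟦P′⟧ record
antecedents `McGuard ∕ VariationalThm1RegSepCoP7MGB ∕ Gauge9RegSepTopStepGB …` are not used: the chart row holds outright), by restriction to the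
shifted volumes `recordK₀ F Mc k + n`.

HONEST FRAMING.  A statement about the record's CHART and SPACES only: (4.4)'s domain is carried into `U^c_{k+1}` because conditions (i)–(iii) are
elementary for `exp` of small smooth `W` and (iv) is met by the record's unit residual recipe — NOT print's analytic backgrounds; nothing of
Bałaban's analyticity of the PIECES ((3.36)–(3.54)), of (1.18)'s bounds, or of Theorem 3 is asserted, ported or discharged; 27930 (the
representation ∕ format, porter PTA-1) and 27931 (responses) OPEN; K0⁷ `Record13SepCoPHInhabited` NOT closed; NODE O not inhabited (0∕1);
COUNT 8∕28 · K 1∕4 UNMOVED unless the gate says otherwise; finite `𝕋⁴_{L^K}` at fixed ε — NOT continuum ∕ ℝ⁴ ∕ OS; **the Yang–Mills mass gap (Clay)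
is NOT proved by any of this.**  No `def`, `instance`, `notation`, `sorry`; axioms `{propext, Classical.choice, Quot.sound}`.
-/

noncomputable section

open scoped BigOperators Matrix.Norms.L2Operator

namespace Summit.QuantumFields.YangMills.Theorems.PortU2

open Literature.MathematicalPhysics.QuantumFieldTheory.Balaban1983to89
open Literature.MathematicalPhysics.QuantumFieldTheory.Balaban1983to89.Node00
open Literature.MathematicalPhysics.QuantumFieldTheory.Balaban1983to89.T4Continuum (T4Family)
open Summit.QuantumFields.YangMills.Theorems.K0RecordFormatNames
open NormedSpace (exp)

/-! ## §1  (4.4) ⟹ `U^c_{k+1}(X, α₀, α₁)` at the record: the chart maps print's scaled domain into the space of record -/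

section MapsTo

variable (F : T4Family)

open B12RegularSpaces111 Beta.BackgroundVertices

/-- The translations of the fine torus commute. [folklore] -/
private theorem shift_comm {P : Params} (x : Site P 0) (μ ν : Fin P.d) : (x.shift μ).shift ν = (x.shift ν).shift μ := by
  funext κ
  simp only [Site.shift]
  by_cases h1 : κ = ν
  · subst h1
    by_cases h2 : κ = μ
    · subst h2; rfl
    · rw [Function.update_self, Function.update_of_ne h2, Function.update_of_ne h2, Function.update_self]
  · by_cases h2 : κ = μ
    · subst h2
      rw [Function.update_self, Function.update_of_ne h1, Function.update_of_ne h1, Function.update_self]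
    · rw [Function.update_of_ne h1, Function.update_of_ne h2, Function.update_of_ne h2, Function.update_of_ne h1]

/-- `expUnit ℂ 0 = 1` as a unit. [folklore] -/
private theorem expUnit_zero {𝔄 : Type*} [NormedRing 𝔄] [NormedAlgebra ℂ 𝔄] [CompleteSpace 𝔄] : expUnit ℂ (0 : 𝔄) = 1 :=
  Units.ext (by simp [val_expUnit, NormedSpace.exp_zero])

/-- The plaquette variable of the unit configuration is the unit. [cite: Balaban1987RG1, (1.11) p.262 (bookkeeping)] -/
private theorem plaq_one {K : ℕ} (p : Plaq (F.P K) 0) : plaq (1 : PBond (F.P K) 0 → (MatA 2)ˣ) p = 1 := by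
  rw [plaq_eq]; simp

/-- **(4.4) ⟹ membership in `U^c_{k+1}(X, α₀, α₁)` OF RECORD, uniformly in `k`.**  For `0 < α₂ ≤ min(1∕4, α₁, α₀∕16)` the record's chart
carries `recordDom44 … α₂` into `recordUc … α₀ α₁`: the charted configuration `𝐔 = exp W` on the bonds in `X` (and `1` off `X`, `𝐉 = 0`) satisfies
(i)–(iv) of [I] (1.11)–(1.16) with the factorisation `U := 1`, `A′ := (iξ)⁻¹W` — (i) trivially (`∂1 = 1`, the (1.12) gauge `u = 1`, `A = 0`,
`O(1)LMB = 6L+1 > 0`); (ii) `|A′| = ξ⁻¹|W| < α₂ ≤ α₁`, `|∇^ξ A′| = ξ⁻²|W(b+e_μ) − W(b)| < α₂ ≤ α₁` from the first two clauses of (4.4);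
(iii) the plaquette estimate of §1, `|∂𝐔 − 1| ≤ (6α₂ + 6α₂²∕4)ξ² < α₀ξ²`; (iv) holds for the record's UNIT residual recipe (`U_n(M˙(·)) ≡ 1`,
`J_n ≡ 0`, `Record12Residuals`); `Gᶜ`-valuedness is `det exp W = exp tr W = 1`. [cite: Balaban1987RG1, (4.4) p.281, (1.11)–(1.16) p.262] -/
theorem recordChart_mapsTo (Mc k K : ℕ) (X : (recordDomSys F Mc k K).Dom) {α₀ α₁ α₂ : ℝ} (hα₀ : 0 < α₀) (hα₂ : 0 < α₂)
    (h4 : α₂ ≤ 1 / 4) (h1 : α₂ ≤ α₁) (h16 : 16 * α₂ ≤ α₀) :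
    Set.MapsTo (recordChart F Mc k K X) (recordDom44 F Mc k K X α₂) (recordUc F Mc k α₀ α₁ K X) := by
  classical
  intro w hw
  have hξ : 0 < (F.P K).eta (k + 1) := pow_pos (inv_pos.2 (Nat.cast_pos.2 (F.P K).L_pos)) _
  have hξ1 : (F.P K).eta (k + 1) ≤ 1 :=
    pow_le_one₀ (inv_nonneg.2 (Nat.cast_nonneg _)) (inv_le_one_of_one_le₀ (Nat.one_le_cast.2 (F.P K).L_pos))
  obtain ⟨hW1, hW2, -⟩ := hw
  -- abbreviations (plain `have`-equations, no `set`, to keep the record's terms syntactically intact)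
  -- the step's unit in `ℂ`: `iξ ≠ 0`
  have hIξ : (Complex.I * ((F.P K).eta (k + 1) : ℂ)) ≠ 0 :=
    mul_ne_zero Complex.I_ne_zero (by exact_mod_cast hξ.ne')
  have hnIξ : ‖(Complex.I * ((F.P K).eta (k + 1) : ℂ))⁻¹‖ = ((F.P K).eta (k + 1))⁻¹ := by
    rw [norm_inv, norm_mul, Complex.norm_I, one_mul, Complex.norm_real, Real.norm_of_nonneg hξ.le]
  -- the units-valued witness `Ψ = (𝐔, 𝐉)` and the (ii)-factor `A′`
  let Ψ : FieldPair (F.P K) 0 (MatA 2)ˣ (MatA 2) :=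
    ⟨fun b => if b ∈ domBonds F Mc k K X then expUnit ℂ (chartMat F K w b) else 1, fun _ => 0⟩
  let A' : PBond (F.P K) 0 → MatA 2 :=
    fun b => if b ∈ domBonds F Mc k K X then (Complex.I * ((F.P K).eta (k + 1) : ℂ))⁻¹ • chartMat F K w b else 0
  have hΨU : ∀ b, Ψ.U b = if b ∈ domBonds F Mc k K X then expUnit ℂ (chartMat F K w b) else 1 := fun _ => rfl
  have hΨJ : ∀ b, Ψ.J b = 0 := fun _ => rfl
  have hA' : ∀ b, A' b = if b ∈ domBonds F Mc k K X then (Complex.I * ((F.P K).eta (k + 1) : ℂ))⁻¹ • chartMat F K w b else 0 :=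
    fun _ => rfl
  show recordChart F Mc k K X w ∈ recordUc F Mc k α₀ α₁ K X
  rw [recordUc, Set.mem_preimage, recordChart, decodeCfg_encodeCfg]
  refine ⟨Ψ, ?_, ?_⟩
  swap
  · -- `embedPair Ψ` is the charted pair
    refine Prod.ext (funext fun b => ?_) rfl
    show ((Ψ.U b : (MatA 2)ˣ) : MatA 2) = if b ∈ domBonds F Mc k K X then exp (chartMat F K w b) else 1
    rw [hΨU]
    split_ifs <;> simp
  -- `Ψ` satisfies (i)–(iv): its own orbit lies in the space
  refine mem_space_of_satisfies ⟨?_, ?_, 1, A', ?_, ?_, ?_, ?_, ?_, ?_⟩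
  · -- `𝐔` is `Gᶜ = SL(2, ℂ)`-valued on `X`
    intro b hb
    have hb' : b ∈ domBonds F Mc k K X := hb
    rw [hΨU, if_pos hb', B12RegularSpaces111SpecialUnitary.mem_suModel_Gc, val_expUnit]
    exact det_exp_chartMat F K w b
  · -- `𝐉 = 0` is `𝔤ᶜ`-valued
    intro b _
    rw [hΨJ]
    exact Submodule.zero_mem _
  · -- the factorisation `𝐔 = exp(iξA′) · 1`
    intro b
    rw [Pi.one_apply, mul_one, hΨU, hA', expI]
    by_cases hb : b ∈ domBonds F Mc k K X
    · rw [if_pos hb, if_pos hb, smul_smul]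
      show expUnit ℂ (chartMat F K w b) = expUnit ℂ ((Complex.I * ((F.P K).eta (k + 1) : ℂ) * (Complex.I * ((F.P K).eta (k + 1) : ℂ))⁻¹) • chartMat F K w b)
      rw [mul_inv_cancel₀ hIξ, one_smul]
    · rw [if_neg hb, if_neg hb, smul_zero, expUnit_zero]
  · -- (i) for `U = 1`
    refine ⟨fun b _ => Subgroup.one_mem _, fun p _ => ?_, fun C _ => ⟨1, fun _ => Subgroup.one_mem _, fun _ => 0, fun b _ => ?_, fun b _ => ?_, fun q _ => ?_⟩⟩
    · rw [plaq_one, Units.val_one, sub_self, norm_zero]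
      show 0 < α₀ * (F.P K).eta (k + 1) ^ 2
      positivity
    · show gaugeU 1 1 b = expI ((F.P K).eta (k + 1)) 0
      rw [expI, smul_zero, expUnit_zero]
      simp [gaugeU]
    · rw [norm_zero]
      show 0 < recordCB F * α₀
      exact mul_pos (recordCB_pos F) hα₀
    · simp only [grad, sub_self, smul_zero, norm_zero]
      show 0 < recordCB F * α₀
      exact mul_pos (recordCB_pos F) hα₀
  · -- (ii) for `A′ = (iξ)⁻¹ W` in the background `U = 1`
    refine ⟨fun b hb => ?_, fun b hb => ?_, fun q hq => ?_⟩
    · have hb' : b ∈ domBonds F Mc k K X := hb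
      rw [hA', if_pos hb', B12RegularSpaces111SpecialUnitary.mem_suModel_gc, Matrix.trace_smul, trace_chartMat, smul_zero]
    · have hb' : b ∈ domBonds F Mc k K X := hb
      rw [hA', if_pos hb', norm_smul, hnIξ]
      have h := hW1 b hb'
      calc ((F.P K).eta (k + 1))⁻¹ * ‖chartMat F K w b‖ < ((F.P K).eta (k + 1))⁻¹ * (α₂ * (F.P K).eta (k + 1)) :=
          mul_lt_mul_of_pos_left h (inv_pos.2 hξ)
        _ = α₂ := by field_simp
        _ ≤ α₁ := h1
    · -- `q = (x, μ, ν)` with its four corners in `X`: the bonds `⟨x, ν⟩`, `⟨x + e_μ, ν⟩` lie in `X`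
      obtain ⟨hx, hxμ, hxν, hxμν⟩ := hq
      have hb0 : (⟨q.1, q.2.2⟩ : PBond (F.P K) 0) ∈ domBonds F Mc k K X := ⟨hx, hxν⟩
      have hb1 : (⟨q.1.shift q.2.1, q.2.2⟩ : PBond (F.P K) 0) ∈ domBonds F Mc k K X := ⟨hxμ, hxμν⟩
      have hd := hW2 ⟨q.1, q.2.2⟩ hb0 q.2.1 hb1
      rw [nabla_one, grad]
      show ‖((F.P K).eta (k + 1) : ℂ)⁻¹ • (A' ⟨q.1.shift q.2.1, q.2.2⟩ - A' ⟨q.1, q.2.2⟩)‖ < α₁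
      rw [hA', hA', if_pos hb1, if_pos hb0, ← smul_sub, smul_smul, norm_smul, norm_mul, norm_inv, Complex.norm_real,
        Real.norm_of_nonneg hξ.le, hnIξ]
      calc ((F.P K).eta (k + 1))⁻¹ * ((F.P K).eta (k + 1))⁻¹ *
            ‖chartMat F K w ⟨q.1.shift q.2.1, q.2.2⟩ - chartMat F K w ⟨q.1, q.2.2⟩‖
          < ((F.P K).eta (k + 1))⁻¹ * ((F.P K).eta (k + 1))⁻¹ * (α₂ * (F.P K).eta (k + 1) ^ 2) :=
            mul_lt_mul_of_pos_left hd (by positivity)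
        _ = α₂ := by field_simp
        _ ≤ α₁ := h1
  · -- (iii): the plaquette estimate, `𝐉 = 0`
    refine ⟨fun p hp => ?_, fun b _ => by rw [hΨJ, norm_zero]; exact hα₀⟩
    obtain ⟨hs, hsμ, hsν, hsμν⟩ := hp
    have hsνμ : (p.src.shift p.ν).shift p.μ ∈ Sect2.domSites (F.P K) Mc (k + 1) X := by rw [← shift_comm]; exact hsμν
    have hbA : (⟨p.src, p.μ⟩ : PBond (F.P K) 0) ∈ domBonds F Mc k K X := ⟨hs, hsμ⟩
    have hbB : (⟨p.src.shift p.μ, p.ν⟩ : PBond (F.P K) 0) ∈ domBonds F Mc k K X := ⟨hsμ, hsμν⟩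
    have hbC : (⟨p.src.shift p.ν, p.μ⟩ : PBond (F.P K) 0) ∈ domBonds F Mc k K X := ⟨hsν, hsνμ⟩
    have hbD : (⟨p.src, p.ν⟩ : PBond (F.P K) 0) ∈ domBonds F Mc k K X := ⟨hs, hsν⟩
    have hval : ((plaq Ψ.U p : (MatA 2)ˣ) : MatA 2) =
        exp (chartMat F K w ⟨p.src, p.μ⟩) * exp (chartMat F K w ⟨p.src.shift p.μ, p.ν⟩) *
          exp (-chartMat F K w ⟨p.src.shift p.ν, p.μ⟩) * exp (-chartMat F K w ⟨p.src, p.ν⟩) := by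
      rw [plaq_eq]
      simp only [Units.val_mul, hΨU, if_pos hbA, if_pos hbB, if_pos hbC, if_pos hbD, val_expUnit, val_inv_expUnit]
    rw [hval]
    have hAC : ‖chartMat F K w ⟨p.src, p.μ⟩ - chartMat F K w ⟨p.src.shift p.ν, p.μ⟩‖ ≤ α₂ * (F.P K).eta (k + 1) ^ 2 := by
      rw [norm_sub_rev]; exact (hW2 ⟨p.src, p.μ⟩ hbA p.ν hbC).le
    have hBD : ‖chartMat F K w ⟨p.src.shift p.μ, p.ν⟩ - chartMat F K w ⟨p.src, p.ν⟩‖ ≤ α₂ * (F.P K).eta (k + 1) ^ 2 :=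
      (hW2 ⟨p.src, p.ν⟩ hbD p.μ hbB).le
    -- the coefficient `2α₂(1 + α₂)e^{4α₂} < 16α₂ ≤ α₀` for `α₂ ≤ 1∕4`
    have he : Real.exp (4 * α₂) < 3 :=
      lt_of_le_of_lt (Real.exp_le_exp.2 (by linarith)) (lt_trans Real.exp_one_lt_d9 (by norm_num))
    have hcoef : 2 * α₂ * (1 + α₂) * Real.exp (4 * α₂) < α₀ := by
      have hpos : 0 < 2 * α₂ * (1 + α₂) := by positivity
      calc 2 * α₂ * (1 + α₂) * Real.exp (4 * α₂) < 2 * α₂ * (1 + α₂) * 3 := mul_lt_mul_of_pos_left he hpos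
        _ ≤ α₀ := by nlinarith
    show ‖exp (chartMat F K w ⟨p.src, p.μ⟩) * exp (chartMat F K w ⟨p.src.shift p.μ, p.ν⟩) *
          exp (-chartMat F K w ⟨p.src.shift p.ν, p.μ⟩) * exp (-chartMat F K w ⟨p.src, p.ν⟩) - 1‖ < α₀ * (F.P K).eta (k + 1) ^ 2
    calc ‖exp (chartMat F K w ⟨p.src, p.μ⟩) * exp (chartMat F K w ⟨p.src.shift p.μ, p.ν⟩) *
          exp (-chartMat F K w ⟨p.src.shift p.ν, p.μ⟩) * exp (-chartMat F K w ⟨p.src, p.ν⟩) - 1‖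
        ≤ 2 * α₂ * (1 + α₂) * Real.exp (4 * α₂) * (F.P K).eta (k + 1) ^ 2 :=
          norm_plaquette_exp_sub_one_le_scaled _ _ _ _ hα₂.le hξ.le hξ1 (hW1 _ hbA).le (hW1 _ hbB).le (hW1 _ hbC).le
            (hW1 _ hbD).le hAC hBD
      _ < α₀ * (F.P K).eta (k + 1) ^ 2 := mul_lt_mul_of_pos_right hcoef (pow_pos hξ 2)
  · -- (iv) for `𝐔`: the record's residual recipe is the UNIT one (`U_n(M˙(·)) ≡ 1`, `J_n ≡ 0`)
    refine ⟨fun n _ _ p _ => ?_, fun n _ _ b _ => ?_⟩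
    · show ‖((plaq (1 : PBond (F.P K) 0 → (MatA 2)ˣ) p : (MatA 2)ˣ) : MatA 2) - 1‖ < α₀ * (F.P K).eta (k + 1) ^ 2
      rw [plaq_one, Units.val_one, sub_self, norm_zero]; positivity
    · show ‖(0 : MatA 2)‖ < α₀ * (((F.P K).L : ℝ) ^ n * (F.P K).eta (k + 1)) ^ 2
      rw [norm_zero]
      have hL : (0 : ℝ) < (F.P K).L := Nat.cast_pos.2 (F.P K).L_pos
      positivity
  · -- (iv) for `U = 1`: the same
    refine ⟨fun n _ _ p _ => ?_, fun n _ _ b _ => ?_⟩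
    · show ‖((plaq (1 : PBond (F.P K) 0 → (MatA 2)ˣ) p : (MatA 2)ˣ) : MatA 2) - 1‖ < α₀ * (F.P K).eta (k + 1) ^ 2
      rw [plaq_one, Units.val_one, sub_self, norm_zero]; positivity
    · show ‖(0 : MatA 2)‖ < α₀ * (((F.P K).L : ℝ) ^ n * (F.P K).eta (k + 1)) ^ 2
      rw [norm_zero]
      have hL : (0 : ℝ) < (F.P K).L := Nat.cast_pos.2 (F.P K).L_pos
      positivity

end MapsTo

/-! ## §2  The repaired 27932‴ body at the names for EVERY volume `K`, its `k`-uniform radius, and the signed text -/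

section Closing

variable (F : T4Family)

/-- **`Chart44DAt` holds** for `0 < α₂ ≤ min(1∕4, α₁, α₀∕16)` — all volumes `K`, all domains `X`, every level `k` with the SAME `α₂`.
[cite: Balaban1987RG1, (4.4) p.281, (1.11)–(1.16) p.262] -/
theorem chart44DAt_of_le (Mc k : ℕ) {α₀ α₁ α₂ : ℝ} (hα₀ : 0 < α₀) (hα₂ : 0 < α₂) (h4 : α₂ ≤ 1 / 4) (h1 : α₂ ≤ α₁)
    (h16 : 16 * α₂ ≤ α₀) : Chart44DAt F Mc k α₀ α₁ α₂ := by
  intro K X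
  obtain ⟨hc, hb, ho⟩ := convex_balanced_isOpen_recordDom44 F Mc k K X α₂
  exact ⟨hc, hb, ho, zero_mem_recordDom44 F Mc k K X hα₂, analyticOnNhd_recordChart F Mc k K X _,
    recordChart_mapsTo F Mc k K X hα₀ hα₂ h4 h1 h16⟩

/-- **The radius `α₂` is uniform in the level `k` (and in `Mc`, `K`, `X`)**: `α₂ := min(1∕4, α₁, α₀∕16)` depends on `α₀, α₁` only — print's
«constants independent of k» for the chart row, in the SCALED currency of (4.4). [cite: Balaban1987RG1, (4.4) p.281, Thm 3 p.264] -/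
theorem exists_chart44DAt {α₀ α₁ : ℝ} (hα₀ : 0 < α₀) (hα₁ : 0 < α₁) :
    ∃ α₂ : ℝ, 0 < α₂ ∧ ∀ Mc k : ℕ, Chart44DAt F Mc k α₀ α₁ α₂ := by
  refine ⟨min (1 / 4) (min α₁ (α₀ / 16)), lt_min (by norm_num) (lt_min hα₁ (by linarith)), fun Mc k => ?_⟩
  refine chart44DAt_of_le F Mc k hα₀ (lt_min (by norm_num) (lt_min hα₁ (by linarith))) (min_le_left _ _)
    ((min_le_right _ _).trans (min_le_left _ _)) ?_
  have : min (1 / 4) (min α₁ (α₀ / 16)) ≤ α₀ / 16 := (min_le_right _ _).trans (min_le_right _ _)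
  linarith

/-- **PORT PT-C — the signed text of `BalabanUVNodes.PortRowE118U2` (stmt-QuantumFields-27932), verbatim, PROVED.**  Under the ⟦P′⟧ record
antecedents (unused: the chart row holds outright at the record's names), for all `α₀, α₁ > 0` there is ONE `α₂ > 0` such that for EVERY level
`k`, print's chart obligation `B12FormatPlus.Chart44D` holds for the record's shifted families (volumes `recordK₀ F Mc k + n`): the (4.4) domain
`recordDom44 … α₂` is convex, balanced, open, contains `0`, the exp-chart `recordChart` is analytic on it and maps it into `U^c_{k+1}(X, α₀, α₁)`
of record.  The witness `α₂ = min(1∕4, α₁, α₀∕16)` is `k`-uniform because (4.4) is stated in the ξ-SCALED norms (CRIT-1's R-O2 repair; the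
unscaled polydisc text was false at these names).  HONEST: a statement about the record's CHART and SPACES only — condition (iv) is met because
the record's residual recipe is the unit one; nothing of Bałaban's analyticity of the PIECES ((3.36)–(3.54)) or of Theorem 3 is asserted or
discharged here. [cite: Balaban1987RG1, (4.4) p.281, (1.11)–(1.16) p.262, (1.18) p.263] -/
theorem portRowE118U2 :
    ∀ (F : Literature.MathematicalPhysics.QuantumFieldTheory.Balaban1983to89.T4Continuum.T4Family) (Mc : ℕ) (j c c₀ c₁ : ℕ) (B₃ B₃' a₀ a₁ : ℝ), Summit.QuantumFields.YangMills.Theorems.K0RecordFormatNames.McGuard F Mc → c ≤ F.L ^ j → c₀ ≤ j + 1 → c₁ ≤ j → 2 * (F.L : ℝ) ^ 2 ≤ B₃ → 0 < B₃' → 0 < a₀ → 0 < a₁ → Literature.MathematicalPhysics.QuantumFieldTheory.Balaban1983to89.Node00.VariationalThm1RegSepCoP7MGB F 2 (fun ν M g K k _s => c ≤ ν.M₁ ∧ k + c₀ ≤ F.m + K ∧ F.L ^ c₁ ∣ M ∧ ∀ i, 1 ≤ i → i ≤ k → Literature.MathematicalPhysics.QuantumFieldTheory.Balaban1983to89.Node00.dCubeSide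 (F.P K).L M (Literature.MathematicalPhysics.QuantumFieldTheory.Balaban1983to89.Node00.RkOfRecord (F.P K).L ν.r (g i)) i ∣ (F.P K).sitesPerDir 0) (Literature.MathematicalPhysics.QuantumFieldTheory.Balaban1983to89.Node00.lamDatum F) (Literature.MathematicalPhysics.QuantumFieldTheory.Balaban1983to89.Node00.dataSmall7LamTopOf F 2) B₃ a₀ a₁ → Literature.MathematicalPhysics.QuantumFieldTheory.Balaban1983to89.Node00.Gauge9RegSepTopStepGB F 2 (fun ν K Ω => Literature.MathematicalPhysics.QuantumFieldTheory.Balaban1983to89.Node00.suppDomOfRecord F ν K Ω) (F.L ^ j) (fun ν M g K k _s => c ≤ ν.M₁ ∧ k + c₀ ≤ F.m + K ∧ F.L ^ c₁ ∣ M ∧ ∀ i, 1 ≤ i → i ≤ k → Literature.MathematicalPhysics.QuantumFieldTheory.Balaban1983to89.Node00.dCubeSide (F.P K).L M (Literature.MathematicalPhysics.QuantumFieldTheory.Balaban1983to89.Node00.RkOfRecord (F.P K).L ν.r (g i)) i ∣ (F.P K).sitesPerDir 0) (Literature.MathematicalPhysics.QuantumFieldTheory.Balaban1983to89.Node00.lamDatum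 F) (Literature.MathematicalPhysics.QuantumFieldTheory.Balaban1983to89.Node00.dataSmall7LamTopOf F 2) B₃ B₃' a₀ a₁ → ∀ α₀ α₁ : ℝ, 0 < α₀ → 0 < α₁ → ∃ α₂ : ℝ, 0 < α₂ ∧ ∀ k : ℕ, Literature.MathematicalPhysics.QuantumFieldTheory.Balaban1983to89.B12FormatPlus.Chart44D (fun n => Summit.QuantumFields.YangMills.Theorems.K0RecordFormatNames.recordDomSys F Mc k (Summit.QuantumFields.YangMills.Theorems.K0RecordFormatNames.recordK₀ F Mc k + n)) (fun n => Summit.QuantumFields.YangMills.Theorems.K0RecordFormatNames.recordBondCount F (Summit.QuantumFields.YangMills.Theorems.K0RecordFormatNames.recordK₀ F Mc k + n)) (fun n => Summit.QuantumFields.YangMills.Theorems.K0RecordFormatNames.recordUc F Mc k α₀ α₁ (Summit.QuantumFields.YangMills.Theorems.K0RecordFormatNames.recordK₀ F Mc k + n)) (fun n => Summit.QuantumFields.YangMills.Theorems.K0RecordFormatNames.recordChartDim F (Summit.QuantumFields.YangMills.Theorems.K0RecordFormatNames.recordK₀ F Mc k + n)) (fun n => Summit.QuantumFields.YangMills.Theorems.K0RecordFormatNames.recordChart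 F Mc k (Summit.QuantumFields.YangMills.Theorems.K0RecordFormatNames.recordK₀ F Mc k + n)) (fun n X => Summit.QuantumFields.YangMills.Theorems.K0RecordFormatNames.recordDom44 F Mc k (Summit.QuantumFields.YangMills.Theorems.K0RecordFormatNames.recordK₀ F Mc k + n) X α₂) := by
  intro F Mc _ _ _ _ _ _ _ _ _ _ _ _ _ _ _ _ _ _ α₀ α₁ hα₀ hα₁
  obtain ⟨α₂, hα₂, h⟩ := exists_chart44DAt F hα₀ hα₁
  exact ⟨α₂, hα₂, fun k n X => h Mc k (recordK₀ F Mc k + n) X⟩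

end Closing

end Summit.QuantumFields.YangMills.Theorems.PortU2

end
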